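import Summits.QuantumFields.YangMills.Theorems.BalabanUVNodesN21ExpChartSurjective

/-!
# N21 (NE7c) · THE SHARP RADIUS `√2·π` OF THE `SU(N)` EXPONENTIAL CHART, I: the trace-free chart `expPtSU` is ONE-TO-ONE on the
# OPEN Hilbert–Schmidt ball of radius `√2·π` for EVERY `N` (file 19 A2: NOT one-to-one on the closed `√2·π`-ball, `N ≥ 2`), and
# its differential is invertible there (tree: closed `π`-ball for both)

Width seat pub-ymgap-dag-n21-w1 (g4; director-ym №197 ∕ HUMAN RULING D-0149), node N21 = NE7c (NOT PRINTED in [Bałaban 1983–89], NOT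
proved), lane K3⁸ `SpineGivenEndpointR13SepCoPHV` (stmt-QuantumFields-27366, KEY MAP v2; lineage K3⁷ stmt-QuantumFields-20544),
`--kind proof --supports … --as helper`.  File 23 of the seat's chain (file 24 `…N21ExpChartSharpRadiusHaar` carries the measure half:
(CH)₁, the realized (M1) engine and file 18's properness on every window `S < √2·π`).  THEOREMS ONLY: 0 `def`, 0 `sorry`; count-neutral.
Imports file 19 `…N21ExpChartSurjective` (hence file 18 and pub-balaban's `ShellMeasureExpHaarClosedBallSUN` ∕ `…ExpHaarAreaSUN` ∕
`…ExpInjectiveSUN` ∕ `…ExpJacobianSUN` ∕ `…ExpDuhamelDetSUN`).  NO Theses import.  Restates nothing; cites by name.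

WHY.  The tree's chart road for `SU(N)` runs on windows `‖v‖_HS ≤ S` with `S ≤ π`: injectivity
(`ShellMeasureExpInjectiveSUN.expPtSU_injOn`, `S < π`; `ShellMeasureExpHaarClosedBallSUN.expPtSU_injOn_pi`, `S = π`), invertible differential
(`det_duhT_pos_of_norm_le_pi`), the area formula and (CH)₁ (`haar_restrict_expBallSU_le`), the realized (M1) engine
(`slotAntiConcentration_realized_suN_le`) and file 18's properness (`haar_expBallSU_lt_one`) all carry `S ≤ π`, because the proofs bound each
eigenvalue angle `|θ_k| ≤ ‖v‖` separately and read the principal logarithm.  Only at `N = 2` does the tree reach `S < √2·π`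
(`ShellMeasureExpHaarSU2.hCH_two_of_lt`, through the quaternion chart).  File 19 (A2 `expPtSU_not_injOn_of_sqrt_two_mul_pi_le`) showed the
chart is NOT one-to-one on the closed `√2·π`-ball for `N ≥ 2` and concluded that the radius `π` "cannot be pushed to `√2·π`".  Files 23–24
close the gap `(π, √2·π)`: everything holds on every window `S < √2·π`, for every `N`, so `√2·π` is the EXACT injectivity radius of the
trace-free chart.

THE TWO OBSERVATIONS.  (i) What the Jacobian, the differential and the functional calculus need is not `|θ_k| < π` but the eigenvalue GAPS
`|θ_i − θ_j| < 2π`, and `(θ_i − θ_j)² ≤ 2(θ_i² + θ_j²) ≤ 2·Σθ² = 2‖v‖²` gives them on the open `√2·π`-ball (§1) — no trace condition used.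
(ii) Injectivity beyond `π` cannot read the principal logarithm (angles exceed `π`); instead (§3–§4): with gaps `< 2π` the map `θ ↦ e^{iθ}` is
one-to-one ON THE SPECTRUM OF `v`, so a Lagrange polynomial `p` with `p(e^{iθ_k}) = iθ_k` exists and `genSU v = p(exp genSU v)`; if
`exp genSU v = exp genSU w` this puts `H(v)` in `w`'s eigenframe with real angles `α`, `e^{iα_k} = e^{iφ_k}`, so `α − φ ∈ 2πℤ^N`
componentwise; the TRACE (`Σα = Σφ = 0`) and the gaps of both (`< 2π`) force `α = φ` (§2: a non-zero integer vector with zero sum has a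
coordinate `≥ 1` and one `≤ −1`, i.e. two gaps adding to `≥ 4π`).  In `𝔲(N)` (no trace condition) the radius is `π`
(`diag(iπ, 0)` and `diag(−iπ, 0)` share `diag(−1, 1)`); the trace buys exactly the factor `√2`.

WHAT IS PROVED ([folklore]; pub-balaban modules and files 18 ∕ 19 credited by name).
* §1 `sq_add_sq_le_sum_sq` (`(a−b)² ≤ 2(a²+b²)` is the tree's `Literature.Analysis.FunctionSpaces.sq_sub_le_two_mul`, inlined), `abs_sub_lt_two_pi_of_sum_sq_lt` ∕ `abs_sub_le_two_pi_of_sum_sq_le`; for chart points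
  `abs_sub_eigen_lt_two_pi_of_norm_lt` (‖v‖ < √2·π) ∕ `abs_sub_eigen_le_two_pi_of_norm_le` (‖v‖ ≤ √2·π); `pi_lt_sqrt_two_mul_pi`.
* §2 `eq_of_cexp_mul_I_eq_of_abs_sub_lt` (`e^{ia} = e^{ib}`, `|a − b| < 2π ⇒ a = b`); ★ `eq_of_sum_eq_of_gaps_of_sub_mem_zmultiples`.
* §3 `conjDiag_injective`; `exists_poly_eval_cexp_mul_I` (the interpolant on a spectrum with gaps `< 2π`); `exists_real_eigen_of_herm_eq_conjDiag`.
* §4 ★ `exists_real_eigen_of_exp_eq_conjDiag` (on the open ball `H(v)` is diagonal, with real angles, in EVERY eigenframe of the chart point);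
  ★★ `expPtSU_injOn_of_lt_sqrt_two_mul_pi` (`S < √2·π ⇒ InjOn expPtSU (closedBall 0 S)`, every `N`); ★★ `expPtSU_injOn_ball_sqrt_two_mul_pi`
  (the OPEN ball); `expChartSU_injOn_of_lt`, `expFibreChartSU_injOn_of_lt`, `injOn_expM_of_lt`; `isClosedEmbedding_restrict_expPtSU_of_lt`,
  `measurableEmbedding_restrict_expPtSU_of_lt`.
* §5 `det_duhT_pos_of_norm_lt`, `injective_fderiv_expM_of_norm_lt` (‖v‖ < √2·π).

HONEST FRAMING.  [folklore] linear algebra; no located letter of any N21 road is touched; types nothing of Bałaban's; (M1) ∕ NE7c NOT PRINTED ∕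
NOT proved; **N21 NOT discharged**; K3⁸ NOT claimed; counts unmoved (typed 28∕28 · discharged 5∕27); never a count claim; one finite 𝕋⁴ at fixed
ε — R4 would close only the conditional finite-𝕋⁴ rung `BalabanLadder.UV`, NOT the Yang–Mills mass gap (Clay); nothing about ℝ⁴ ∕ OS.  No decl
below carries a cite tag.
-/

set_option autoImplicit false

noncomputable section

open scoped BigOperators ENNReal
open MeasureTheory Set Function Metric Matrix Finset
open Complex (I)

namespace Summit.QuantumFields.YangMills.Theorems.N21ExpChartSharpRadius

open Literature.MathematicalPhysics.QuantumFieldTheory.Balaban1983to89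
open Literature.MathematicalPhysics.QuantumFieldTheory.Balaban1983to89.T4AdjointCovarianceUnitary (lieSU)
open Summit.QuantumFields.BalabanUV.T4Continuum
open Summit.QuantumFields.BalabanUV.T4Continuum.ShellMeasureExpChartSUN
  (SUN ChartSU coordSU genSU expPtSU coe_expPtSU expChartSU expFibreChartSU BlockChartSU
    norm_apply_le_of_mem_closedBall continuous_expPtSU)
open Summit.QuantumFields.BalabanUV.T4Continuum.ShellMeasureVandermondeSUN
  (conjDiag star_coe_mul_coe star_conjDiag smul_conjDiag)
open Summit.QuantumFields.BalabanUV.T4Continuum.ShellMeasureExpJacobianSUN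
  (herm isHermitian_herm genSU_eq_I_smul_herm exists_conjDiag exp_genSU_eq_conjDiag norm_sq_eq_sum_sq)
open Summit.QuantumFields.BalabanUV.T4Continuum.ShellMeasureExpInjectiveSUN (aeval_conjDiag aeval_exp_eq_genSU)
open Summit.QuantumFields.BalabanUV.T4Continuum.ShellMeasureExpHaarClosedBallSUN (sum_eigen_eq_zero)

variable {N : ℕ}

/-! ## §1 Eigenvalue GAPS are `< 2π` on the open Hilbert–Schmidt ball of radius `√2·π` (no trace condition) -/

section Gaps

/-- two squares of a family are bounded by the sum of all squares (`i ≠ j`). [folklore] -/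
theorem sq_add_sq_le_sum_sq {ι : Type*} [Fintype ι] [DecidableEq ι] (θ : ι → ℝ) {i j : ι} (hij : i ≠ j) :
    θ i ^ 2 + θ j ^ 2 ≤ ∑ k, θ k ^ 2 := by
  rw [← sum_pair (f := fun k => θ k ^ 2) hij]
  exact sum_le_sum_of_subset_of_nonneg (subset_univ _) fun k _ _ => sq_nonneg (θ k)

/-- **GAPS FROM THE SUM OF SQUARES**: `Σ θ² < 2π² ⇒ |θ_j − θ_i| < 2π` for all `i, j`. [folklore] -/
theorem abs_sub_lt_two_pi_of_sum_sq_lt {ι : Type*} [Fintype ι] {θ : ι → ℝ} (h : ∑ k, θ k ^ 2 < 2 * Real.pi ^ 2)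
    (i j : ι) : |θ j - θ i| < 2 * Real.pi := by
  classical
  by_cases hij : j = i
  · rw [hij, sub_self, abs_zero]; positivity
  refine abs_lt_of_sq_lt_sq ?_ (by positivity)
  calc (θ j - θ i) ^ 2 ≤ 2 * (θ j ^ 2 + θ i ^ 2) := by nlinarith [sq_nonneg (θ j + θ i)]
    _ ≤ 2 * ∑ k, θ k ^ 2 := by gcongr; exact sq_add_sq_le_sum_sq θ hij
    _ < 2 * (2 * Real.pi ^ 2) := by gcongr
    _ = (2 * Real.pi) ^ 2 := by ring

/-- `Σ θ² ≤ 2π² ⇒ |θ_j − θ_i| ≤ 2π`. [folklore] -/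
theorem abs_sub_le_two_pi_of_sum_sq_le {ι : Type*} [Fintype ι] {θ : ι → ℝ} (h : ∑ k, θ k ^ 2 ≤ 2 * Real.pi ^ 2)
    (i j : ι) : |θ j - θ i| ≤ 2 * Real.pi := by
  classical
  by_cases hij : j = i
  · rw [hij, sub_self, abs_zero]; positivity
  refine abs_le_of_sq_le_sq ?_ (by positivity)
  calc (θ j - θ i) ^ 2 ≤ 2 * (θ j ^ 2 + θ i ^ 2) := by nlinarith [sq_nonneg (θ j + θ i)]
    _ ≤ 2 * ∑ k, θ k ^ 2 := by gcongr; exact sq_add_sq_le_sum_sq θ hij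
    _ ≤ 2 * (2 * Real.pi ^ 2) := by gcongr
    _ = (2 * Real.pi) ^ 2 := by ring

/-- `‖v‖ < √2·π ⇒ ‖v‖² < 2π²`. [folklore] -/
theorem sq_lt_two_mul_pi_sq_of_lt {x : ℝ} (hx0 : 0 ≤ x) (hx : x < Real.sqrt 2 * Real.pi) : x ^ 2 < 2 * Real.pi ^ 2 := by
  have h := pow_lt_pow_left₀ hx hx0 two_ne_zero
  rwa [mul_pow, Real.sq_sqrt zero_le_two] at h

/-- `‖v‖ ≤ √2·π ⇒ ‖v‖² ≤ 2π²`. [folklore] -/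
theorem sq_le_two_mul_pi_sq_of_le {x : ℝ} (hx0 : 0 ≤ x) (hx : x ≤ Real.sqrt 2 * Real.pi) : x ^ 2 ≤ 2 * Real.pi ^ 2 := by
  have h := pow_le_pow_left₀ hx0 hx 2
  rwa [mul_pow, Real.sq_sqrt zero_le_two] at h

variable {v : ChartSU N} {U : Matrix.unitaryGroup (Fin N) ℂ} {θ : Fin N → ℝ}

/-- **ALL EIGENVALUE GAPS ARE `< 2π` ON THE OPEN `√2·π`-BALL**: `‖v‖_HS < √2·π ⇒ |θ_j − θ_i| < 2π` — the input of
`ShellMeasureExpDuhamelDetSUN.prod_sinc_sq_pos` (invertible differential) and of §3's interpolation; compare the tree's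
`ShellMeasureExpHaarClosedBallSUN.abs_sub_eigen_lt_two_pi` (`‖v‖ ≤ π`, via `|θ_k| < π` and the trace). [folklore] -/
theorem abs_sub_eigen_lt_two_pi_of_norm_lt (h : herm v = conjDiag U fun k => (θ k : ℂ)) (hv : ‖v‖ < Real.sqrt 2 * Real.pi)
    (i j : Fin N) : |θ j - θ i| < 2 * Real.pi :=
  abs_sub_lt_two_pi_of_sum_sq_lt ((norm_sq_eq_sum_sq h).symm.trans_lt (sq_lt_two_mul_pi_sq_of_lt (norm_nonneg v) hv)) i j

/-- `‖v‖_HS ≤ √2·π ⇒ |θ_j − θ_i| ≤ 2π` — the input of the Jacobian's centre-monotonicity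
(`ShellMeasureExpJacobianSUN.sinc_sq_half_le_smul`). [folklore] -/
theorem abs_sub_eigen_le_two_pi_of_norm_le (h : herm v = conjDiag U fun k => (θ k : ℂ)) (hv : ‖v‖ ≤ Real.sqrt 2 * Real.pi)
    (i j : Fin N) : |θ j - θ i| ≤ 2 * Real.pi :=
  abs_sub_le_two_pi_of_sum_sq_le ((norm_sq_eq_sum_sq h).symm.trans_le (sq_le_two_mul_pi_sq_of_le (norm_nonneg v) hv)) i j

/-- `π < √2·π`: the new window range contains the tree's. [folklore] -/
theorem pi_lt_sqrt_two_mul_pi : Real.pi < Real.sqrt 2 * Real.pi := by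
  have h1 : (1 : ℝ) < Real.sqrt 2 := by
    rw [show (1 : ℝ) = Real.sqrt 1 from Real.sqrt_one.symm]
    exact Real.sqrt_lt_sqrt zero_le_one one_lt_two
  nlinarith [Real.pi_pos]

end Gaps

/-! ## §2 Two angle vectors with equal sums, gaps `< 2π`, and differences in `2πℤ` are equal -/

section Lattice

/-- `e^{ia} = e^{ib}` with `|a − b| < 2π` forces `a = b`. [folklore] -/
theorem eq_of_cexp_mul_I_eq_of_abs_sub_lt {a b : ℝ} (h : Complex.exp (a * I) = Complex.exp (b * I))
    (hab : |a - b| < 2 * Real.pi) : a = b := by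
  obtain ⟨n, hn⟩ := Complex.exp_eq_exp_iff_exists_int.mp h
  have hre : a = b + n * (2 * Real.pi) := by
    have := congrArg Complex.im hn
    simpa using this
  have hn1 : |(n : ℝ)| < 1 := by
    have h2 : |(n : ℝ) * (2 * Real.pi)| < 2 * Real.pi := by rwa [hre, add_sub_cancel_left] at hab
    rw [abs_mul, abs_of_pos Real.two_pi_pos] at h2
    have h3 : |(n : ℝ)| * (2 * Real.pi) < 1 * (2 * Real.pi) := by rwa [one_mul]
    exact lt_of_mul_lt_mul_right h3 Real.two_pi_pos.le
  have hn0 : n = 0 := by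
    have h4 := abs_lt.mp hn1
    have h5 : (-1 : ℤ) < n := by exact_mod_cast h4.1
    have h6 : n < (1 : ℤ) := by exact_mod_cast h4.2
    omega
  rw [hre, hn0, Int.cast_zero, zero_mul, add_zero]

/-- ★ **THE LATTICE STEP**: if `Σ α = Σ β`, all gaps of `α` and of `β` are `< 2π`, and `α_k − β_k ∈ 2πℤ` for every `k`, then
`α = β`.  (A non-zero integer vector with zero sum has a coordinate `≥ 1` and a coordinate `≤ −1`; there the two gap bounds would
add up to `< 4π ≤ (α_j − β_j) − (α_k − β_k)`.) [folklore] -/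
theorem eq_of_sum_eq_of_gaps_of_sub_mem_zmultiples {ι : Type*} [Fintype ι] {α β : ι → ℝ}
    (hsum : ∑ k, α k = ∑ k, β k) (hα : ∀ i j, |α j - α i| < 2 * Real.pi) (hβ : ∀ i j, |β j - β i| < 2 * Real.pi)
    (hn : ∀ k, ∃ n : ℤ, α k = β k + n * (2 * Real.pi)) : α = β := by
  classical
  choose n hn using hn
  -- the integers sum to zero
  have hsum0 : ∑ k, n k = 0 := by
    have h1 : (∑ k, (n k : ℝ)) * (2 * Real.pi) = 0 := by
      rw [sum_mul]
      have : ∑ k, (α k - β k) = 0 := by rw [sum_sub_distrib, hsum, sub_self]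
      rw [← this]
      exact sum_congr rfl fun k _ => by rw [hn k]; ring
    have h2 : ∑ k, (n k : ℝ) = 0 := by
      rcases mul_eq_zero.mp h1 with h | h
      · exact h
      · exact absurd h Real.two_pi_pos.ne'
    exact_mod_cast h2
  -- either all integers vanish …
  by_cases h0 : ∀ k, n k = 0
  · funext k
    rw [hn k, h0 k, Int.cast_zero, zero_mul, add_zero]
  -- … or there is one `≥ 1` and one `≤ −1`
  exfalso
  push Not at h0
  obtain ⟨k₀, hk₀⟩ := h0
  have hpos : ∃ j, 1 ≤ n j := by
    by_contra hcon
    push Not at hcon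
    have hall : ∀ k ∈ (univ : Finset ι), n k ≤ 0 := fun k _ => by have := hcon k; omega
    have := (sum_eq_zero_iff_of_nonpos hall).mp hsum0 k₀ (mem_univ _)
    exact hk₀ this
  have hneg : ∃ k, n k ≤ -1 := by
    by_contra hcon
    push Not at hcon
    have hall : ∀ k ∈ (univ : Finset ι), 0 ≤ n k := fun k _ => by have := hcon k; omega
    have := (sum_eq_zero_iff_of_nonneg hall).mp hsum0 k₀ (mem_univ _)
    exact hk₀ this
  obtain ⟨j, hj⟩ := hpos
  obtain ⟨k, hk⟩ := hneg
  have hj' : (1 : ℝ) ≤ n j := by exact_mod_cast hj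
  have hk' : (n k : ℝ) ≤ -1 := by exact_mod_cast hk
  have h1 := (abs_lt.mp (hα k j)).2
  have h2 := (abs_lt.mp (hβ k j)).1
  rw [hn j, hn k] at h1
  nlinarith [Real.pi_pos]

end Lattice

/-! ## §3 Functional calculus: the generator is a polynomial in the chart point when the gaps are `< 2π` -/

section Calculus

/-- `d ↦ U·diag d·U*` is one-to-one. [folklore] -/
theorem conjDiag_injective (U : Matrix.unitaryGroup (Fin N) ℂ) : Function.Injective (conjDiag U) := by
  intro d e h
  have key : ∀ d : Fin N → ℂ,
      star (U : Matrix (Fin N) (Fin N) ℂ) * conjDiag U d * (U : Matrix (Fin N) (Fin N) ℂ) = diagonal d := fun d => by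
    unfold conjDiag
    rw [Matrix.mul_assoc, Matrix.mul_assoc, star_coe_mul_coe, Matrix.mul_one, ← Matrix.mul_assoc, star_coe_mul_coe,
      Matrix.one_mul]
  have h2 : diagonal d = diagonal e := by rw [← key d, ← key e, h]
  exact diagonal_injective h2

/-- **THE INTERPOLANT OF `e^{iθ} ↦ iθ` ON A SPECTRUM WITH GAPS `< 2π`**: if all `|θ_j − θ_i| < 2π` then `θ ↦ e^{iθ}` is
one-to-one on `{θ_k}`, so some polynomial `p` has `p(e^{iθ_k}) = iθ_k` for every `k` — NO principal logarithm (angles may exceed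
`π`). [folklore] -/
theorem exists_poly_eval_cexp_mul_I (θ : Fin N → ℝ) (hgap : ∀ i j, |θ j - θ i| < 2 * Real.pi) :
    ∃ p : Polynomial ℂ, ∀ k, p.eval (Complex.exp (θ k * I)) = (θ k : ℂ) * I := by
  classical
  let z : Fin N → ℂ := fun k => Complex.exp (θ k * I)
  let s : Finset ℂ := univ.image z
  let r : ℂ → ℂ := fun x => if hx : ∃ k, z k = x then (θ hx.choose : ℂ) * I else 0
  refine ⟨Lagrange.interpolate s id r, fun k => ?_⟩
  have hk : z k ∈ s := mem_image_of_mem _ (mem_univ k)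
  have hev : (Lagrange.interpolate s id r).eval (z k) = r (z k) :=
    Lagrange.eval_interpolate_at_node (r := r) (v := id) (Set.injOn_id _) hk
  have hx : ∃ k', z k' = z k := ⟨k, rfl⟩
  have hr : r (z k) = (θ hx.choose : ℂ) * I := dif_pos hx
  have hθ : θ hx.choose = θ k := eq_of_cexp_mul_I_eq_of_abs_sub_lt hx.choose_spec (hgap k hx.choose)
  rw [hev, hr, hθ]

/-- a Hermitian matrix diagonal in a unitary frame has REAL diagonal entries there. [folklore] -/
theorem exists_real_eigen_of_herm_eq_conjDiag {v : ChartSU N} {V : Matrix.unitaryGroup (Fin N) ℂ} {μ : Fin N → ℂ}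
    (h : herm v = conjDiag V μ) : ∃ α : Fin N → ℝ, herm v = conjDiag V fun k => (α k : ℂ) := by
  have hstar : star μ = μ := by
    apply conjDiag_injective V
    rw [← star_conjDiag, ← h, star_eq_conjTranspose, (isHermitian_herm v).eq]
  refine ⟨fun k => (μ k).re, ?_⟩
  rw [h]
  congr 1
  funext k
  exact (Complex.conj_eq_iff_re.mp (congr_fun hstar k)).symm

end Calculus

/-! ## §4 Injectivity of the exponential chart on every window `S < √2·π` -/

section Injective

/-- ★ **ON THE OPEN `√2·π`-BALL THE GENERATOR IS DIAGONAL IN EVERY EIGENFRAME OF THE CHART POINT**: if `‖v‖_HS < √2·π` and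
`exp (genSU v) = V·diag(d)·V*` for some unitary frame `V`, then `H(v) = V·diag(α)·V*` with REAL angles `α` and `e^{iα_k} = d_k` —
`genSU v` is a polynomial in `exp (genSU v)` (§3), hence diagonal wherever the chart point is. [folklore] -/
theorem exists_real_eigen_of_exp_eq_conjDiag {v : ChartSU N} (hv : ‖v‖ < Real.sqrt 2 * Real.pi)
    {V : Matrix.unitaryGroup (Fin N) ℂ} {d : Fin N → ℂ} (h : NormedSpace.exp (genSU v) = conjDiag V d) :
    ∃ α : Fin N → ℝ, herm v = conjDiag V (fun k => (α k : ℂ)) ∧ ∀ k, Complex.exp (α k * I) = d k := by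
  obtain ⟨U, θ, hθ⟩ := exists_conjDiag v
  obtain ⟨p, hp⟩ := exists_poly_eval_cexp_mul_I θ (abs_sub_eigen_lt_two_pi_of_norm_lt hθ hv)
  have hgen : genSU v = conjDiag V fun k => p.eval (d k) := by
    rw [← aeval_exp_eq_genSU hθ hp, h, aeval_conjDiag]
  have hherm' : herm v = conjDiag V fun k => -I * p.eval (d k) := by
    rw [herm, hgen, smul_conjDiag]
    rfl
  obtain ⟨α, hα⟩ := exists_real_eigen_of_herm_eq_conjDiag hherm'
  exact ⟨α, hα, fun k => congr_fun (conjDiag_injective V ((exp_genSU_eq_conjDiag hα).symm.trans h)) k⟩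

/-- ★★ **THE EXPONENTIAL CHART OF `SU(N)` IS ONE-TO-ONE ON THE BALL `‖v‖_HS ≤ S` FOR EVERY `S < √2·π` AND EVERY `N`.**
With file 19's A2 (`expPtSU_not_injOn_of_sqrt_two_mul_pi_le`: not one-to-one on the closed `√2·π`-ball, `N ≥ 2`) the injectivity
radius of the trace-free chart is EXACTLY `√2·π`; the tree's `expPtSU_injOn` ∕ `expPtSU_injOn_pi` are the cases `S < π` ∕ `S = π`. [folklore] -/
theorem expPtSU_injOn_of_lt_sqrt_two_mul_pi {S : ℝ} (hS : S < Real.sqrt 2 * Real.pi) :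
    InjOn (expPtSU (N := N)) (Metric.closedBall 0 S) := by
  intro v hv w hw hvw
  rw [Metric.mem_closedBall, dist_zero_right] at hv hw
  have hvlt : ‖v‖ < Real.sqrt 2 * Real.pi := hv.trans_lt hS
  have hwlt : ‖w‖ < Real.sqrt 2 * Real.pi := hw.trans_lt hS
  obtain ⟨V, φ, hφ⟩ := exists_conjDiag w
  have hg : NormedSpace.exp (genSU v) = NormedSpace.exp (genSU w) := by
    rw [← coe_expPtSU, ← coe_expPtSU, hvw]
  -- `H(v)` in `w`'s eigenframe, with real angles and the same exponentials angle by angle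
  obtain ⟨α, hα, hexp⟩ := exists_real_eigen_of_exp_eq_conjDiag hvlt (hg.trans (exp_genSU_eq_conjDiag hφ))
  have hn : ∀ k, ∃ n : ℤ, α k = φ k + n * (2 * Real.pi) := fun k => by
    obtain ⟨n, hn⟩ := Complex.exp_eq_exp_iff_exists_int.mp (hexp k)
    refine ⟨n, ?_⟩
    have := congrArg Complex.im hn
    simpa using this
  -- the lattice step: trace + gaps
  have hαφ : α = φ :=
    eq_of_sum_eq_of_gaps_of_sub_mem_zmultiples ((sum_eigen_eq_zero hα).trans (sum_eigen_eq_zero hφ).symm)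
      (abs_sub_eigen_lt_two_pi_of_norm_lt hα hvlt) (abs_sub_eigen_lt_two_pi_of_norm_lt hφ hwlt) hn
  have hgen' : genSU v = genSU w := by
    rw [genSU_eq_I_smul_herm, genSU_eq_I_smul_herm, hα, hφ, hαφ]
  have hc : (coordSU v : lieSU (Fin N)) = coordSU w := Subtype.ext hgen'
  exact (coordSU (N := N)).injective hc

/-- ★★ **… HENCE ON THE OPEN BALL OF RADIUS `√2·π`** — the sharp statement (file 19 A2: two antipodal points of the sphere
`‖v‖ = √2·π` share their exponential). [folklore] -/
theorem expPtSU_injOn_ball_sqrt_two_mul_pi : InjOn (expPtSU (N := N)) (Metric.ball 0 (Real.sqrt 2 * Real.pi)) := by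
  intro v hv w hw hvw
  rw [Metric.mem_ball, dist_zero_right] at hv hw
  have hS : max ‖v‖ ‖w‖ < Real.sqrt 2 * Real.pi := max_lt hv hw
  exact expPtSU_injOn_of_lt_sqrt_two_mul_pi hS (mem_closedBall_zero_iff.mpr (le_max_left _ _))
    (mem_closedBall_zero_iff.mpr (le_max_right _ _)) hvw

/-- the chart about `g` is one-to-one on the ball of radius `S < √2·π`. [folklore] -/
theorem expChartSU_injOn_of_lt (g : SUN N) {S : ℝ} (hS : S < Real.sqrt 2 * Real.pi) :
    InjOn (expChartSU g) (Metric.closedBall 0 S) :=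
  fun _ hv _ hw hvw => expPtSU_injOn_of_lt_sqrt_two_mul_pi hS hv hw (mul_left_cancel (a := g) hvw)

variable {P : Params} {j : ℕ}

/-- **THE BLOCK CHART IS ONE-TO-ONE ON THE WINDOW** `‖x‖ ≤ S`, `S < √2·π`, about every centre `u₀`. [folklore] -/
theorem expFibreChartSU_injOn_of_lt (Λ : Finset (PBond P j)) (u₀ : GaugeField P j (SUN N)) {S : ℝ}
    (hS : S < Real.sqrt 2 * Real.pi) : InjOn (expFibreChartSU Λ u₀) (Metric.closedBall 0 S) := by
  intro x hx y hy hxy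
  funext b
  have hb : expChartSU (u₀ b) (x b) = expChartSU (u₀ b) (y b) := congr_fun hxy b
  exact expChartSU_injOn_of_lt (u₀ b) hS (mem_closedBall_zero_iff.mpr (norm_apply_le_of_mem_closedBall Λ hx b))
    (mem_closedBall_zero_iff.mpr (norm_apply_le_of_mem_closedBall Λ hy b)) hb

open ShellMeasureHaarHausdorffSUN (expM) in
/-- the ambient chart `expM = exp ∘ genSU : E_N → M_N(ℂ)` is one-to-one on the ball of radius `S < √2·π`. [folklore] -/
theorem injOn_expM_of_lt {S : ℝ} (hS : S < Real.sqrt 2 * Real.pi) : InjOn (expM (N := N)) (closedBall 0 S) :=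
  fun _ hv _ hw hvw => expPtSU_injOn_of_lt_sqrt_two_mul_pi hS hv hw (Subtype.ext hvw)

open Topology in
/-- on the window `‖v‖ ≤ S`, `S < √2·π`, the chart is a CLOSED EMBEDDING (continuous injection of a compact space) — so the
logarithm read in coordinates is continuous there, beyond the principal branch. [folklore] -/
theorem isClosedEmbedding_restrict_expPtSU_of_lt {S : ℝ} (hS : S < Real.sqrt 2 * Real.pi) :
    IsClosedEmbedding ((Metric.closedBall (0 : ChartSU N) S).restrict (expPtSU (N := N))) := by
  haveI : CompactSpace ↥(Metric.closedBall (0 : ChartSU N) S) :=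
    isCompact_iff_compactSpace.mp (isCompact_closedBall _ _)
  exact (continuous_expPtSU.comp continuous_subtype_val).isClosedEmbedding
    (injOn_iff_injective.mp (expPtSU_injOn_of_lt_sqrt_two_mul_pi hS))

/-- … hence a measurable embedding. [folklore] -/
theorem measurableEmbedding_restrict_expPtSU_of_lt {S : ℝ} (hS : S < Real.sqrt 2 * Real.pi) :
    MeasurableEmbedding ((Metric.closedBall (0 : ChartSU N) S).restrict (expPtSU (N := N))) :=
  (isClosedEmbedding_restrict_expPtSU_of_lt hS).measurableEmbedding

end Injective

/-! ## §5 The differential is invertible on the open `√2·π`-ball -/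

section Differential

open ShellMeasureExpDuhamelSUN (duhT genSU_duhT_eq_integral injective_chartDeriv_of_injective)
open ShellMeasureExpDuhamelDetSUN (det_eq_prod_sinc prod_sinc_sq_pos)
open ShellMeasureHaarHausdorffSUN (expM)
open ShellMeasureExpHaarAreaSUN (fderiv_expM)

/-- **`0 < det T_v` FOR `‖v‖_HS < √2·π`** (pub-balaban's `det_eq_prod_sinc` + `prod_sinc_sq_pos` fed with §1's gaps; tree:
`det_duhT_pos_of_norm_le_pi`).  At `‖v‖ = √2·π` this fails: `θ = (π, −π, 0, …)` has the gap `2π` and `sinc π = 0`. [folklore] -/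
theorem det_duhT_pos_of_norm_lt {v : ChartSU N} (hv : ‖v‖ < Real.sqrt 2 * Real.pi) :
    0 < LinearMap.det (duhT v : ChartSU N →ₗ[ℝ] ChartSU N) := by
  obtain ⟨U, θ, h⟩ := exists_conjDiag v
  rw [det_eq_prod_sinc h _ (genSU_duhT_eq_integral v)]
  exact prod_sinc_sq_pos (abs_sub_eigen_lt_two_pi_of_norm_lt h hv)

/-- **THE DERIVATIVE OF THE AMBIENT CHART IS INJECTIVE FOR `‖v‖_HS < √2·π`.** [folklore] -/
theorem injective_fderiv_expM_of_norm_lt {v : ChartSU N} (hv : ‖v‖ < Real.sqrt 2 * Real.pi) :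
    Injective (fderiv ℝ (expM (N := N)) v) := by
  rw [fderiv_expM]
  exact injective_chartDeriv_of_injective
    (LinearMap.equivOfDetNeZero _ (det_duhT_pos_of_norm_lt hv).ne').injective

end Differential

end Summit.QuantumFields.YangMills.Theorems.N21ExpChartSharpRadius

end
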